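import Summits.CriticalPhenomena.PercolationContinuityZ3.Theses.PercExchangeRateTransport
import Summits.CriticalPhenomena.PercolationContinuityZ3.Theorems.PercNearOneGluingNoHeavyLowerTailCSHTheoremOne
import Literature.Probability.Percolation.CriticalContinuityProofs
import HarnessLib

/-!
# `PercExchangeRateTransport.PcBounds` (stmt-CriticalPhenomena-16067) — SETTLED after continuity

Item `stmt-CriticalPhenomena-16067` of route `CriticalPhenomena/PercExchangeRateTransport` (support): `0 < p_c(ℤ^d) < 1` for `d ≥ 2` (Peierls + tree bound), the Literature named fact `Grimmett1999_criticalProb_pos_lt_one`.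

Literally its Literature discharge `Grimmett1999_criticalProb_pos_lt_one_holds` (CriticalContinuityProofs.lean).  p205010 is NOT used.

builds on p205010 (kernel theorem, internal audit signed; external expert review pending) — USED (`CSH.percolationContinuityZ3_holds`).  RSW3 lane, lead gen 28 (prover-prim-rsw3-lead-g28-0):
'after continuity — the ledger harvest'.
References: G. Kozma, N. Nitzan (2024), Thm. 6 / Conj. 3 [KozmaNitzan2024]; G. Grimmett, *Percolation* (1999), §8 [GrimmettPercolation1999].
-/

noncomputable section

namespace Summit.CriticalPhenomena.PercolationContinuityZ3.Theorems

namespace PercExchangeRateTransportPcBounds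

open MeasureTheory Literature.Probability.Percolation Literature.Probability.LatticeModels

/-- **`PercExchangeRateTransport.PcBounds` (stmt-CriticalPhenomena-16067), settled.**  `Grimmett1999_criticalProb_pos_lt_one_holds`.
[cite: KozmaNitzan2024, Thm. 6 with Conj. 3 (p. 15)] -/
theorem pcBounds_proof : Summit.CriticalPhenomena.PercolationContinuityZ3.Theses.PercExchangeRateTransport.PcBounds := by
  unfold Summit.CriticalPhenomena.PercolationContinuityZ3.Theses.PercExchangeRateTransport.PcBounds
  exact Grimmett1999_criticalProb_pos_lt_one_holds

end PercExchangeRateTransportPcBounds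

end Summit.CriticalPhenomena.PercolationContinuityZ3.Theorems

end
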